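import Literature.AnabelianGeometry.AbsoluteAnabelian.MonoidKummerMapsTMLiftProofs
import HarnessLib

/-!
# [AbsTopIII] Def 3.1 (ii) / Prop 3.2 (iv): `TM`-isomorphisms extend to `TLG`-isomorphisms; the
# mono-analytic `TM` lifting statement REDUCED to the mono-analytic `TLG` lifting statement

Proof-only companion (theorems only, no new definitions) of `MonoidKummerMaps.lean` /
`MLFGaloisPairs.lean` (seat abc-iut-L4-t2; S. Mochizuki, *Topics in Absolute Anabelian Geometry III*,
Def. 3.1 (ii) p. 67, Prop. 3.2 (iv) p. 72, kurims manuscript, lit key `paper:url-5493eb38cbb7`; the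
mono-analytic variants are the form used by [IUTchII] Rmk. 1.11.1 (i)).

* `ModelMLFGaloisData.exists_tlgPair_iso_of_tmPair_iso` — the converse of
  `exists_tmPair_iso_of_tlgPair_iso` (`MonoidKummerMapsTMLiftProofs.lean`): an isomorphism of model
  `TM`-pairs `(Π₁ ↷ 𝒪_{k̄₁}^⊳) ⥲ (Π₂ ↷ 𝒪_{k̄₂}^⊳)` EXTENDS (to fractions `a/b`, `k̄^× = Frac 𝒪^⊳` by
  the valuation trichotomy) to an isomorphism of the model `TLG`-pairs with the same Galois
  component;
* `isOfMonoAnalyticTypeMonoid_tlgPair_of_tmPair` — hence if a `TM`-pair of mono-analytic type is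
  modelled on `(k, k̄, Π_k ↠ G_k)`, the `TLG`-pair of that model data is of mono-analytic type;
* `GaloisMonoidPair.actionKer_eq_bot_of_isOfMonoAnalyticTypeMonoid_TM` / `_TLG` — pairs of
  mono-analytic type have trivial arithmetic kernel (so every `Π ⥲ Π*` respects the quotients);
* `tmPairIso_lifts_of_tlgLifting_monoAnalytic` — the MONO-ANALYTIC `TM` lifting statement ("every
  `Π ⥲ Π*` between MLF-Galois `TM`-pairs of mono-analytic type lifts to an isomorphism of pairs",
  abc-iut-L4-t2's `GaloisIsoLiftsToTMPairIsoOfMonoAnalytic`, typed verbatim here as a conclusion)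
  FOLLOWS from the mono-analytic `TLG` lifting statement (the existence part of the `TLG` clause of
  `UnitPairIsoFibresOfMonoAnalytic`).

HONEST FRAMING: OUR kernel check of reductions between statements; nothing here bears on [IUTchIII]
Cor. 3.12.
-/

noncomputable section

open scoped Classical

namespace Literature.AnabelianGeometry.AbsoluteAnabelian

open _root_.ValuativeRel IntermediateField

universe u

/-! ### §1. Extension of `TM`-isomorphisms to fractions -/

section Extend

variable {C₁ C₂ : MLFClosure.{u}} (D₁ : ModelMLFGaloisData C₁.k C₁.K) (D₂ : ModelMLFGaloisData C₂.k C₂.K)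

/-- Every non-zero element of `k̄` is a quotient of two non-zero integers (indeed `x = x/1` or
`x = 1/x⁻¹`). [cite: MochizukiAbsTopIII2015, Definition 3.1 (i) p.66] -/
theorem MLFClosure.exists_eq_div (C : MLFClosure.{u}) (x : ↥(nonZeroDivisors C.K)) :
    ∃ p : ↥(nonzeroIntegers C.k C.K) × ↥(nonzeroIntegers C.k C.K),
      (x : C.K) = (p.1 : C.K) / (p.2 : C.K) := by
  have hx : (x : C.K) ≠ 0 := nonZeroDivisors.coe_ne_zero x
  rcases C.mem_nonzeroIntegers_or_inv_mem hx with h | h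
  · exact ⟨(⟨x, h⟩, ⟨1, Submonoid.one_mem _⟩), by simp⟩
  · exact ⟨(⟨1, Submonoid.one_mem _⟩, ⟨(x : C.K)⁻¹, h⟩), by simp⟩

/-- **Extension to fractions.**  An isomorphism of the model `TM`-pairs extends to an isomorphism of
the model `TLG`-pairs with the same Galois component (`β(a/b) := β(a)/β(b)`).
[cite: MochizukiAbsTopIII2015, Definition 3.1 (ii) p.67] -/
theorem ModelMLFGaloisData.exists_tlgPair_iso_of_tmPair_iso
    (e : GaloisMonoidPair.Iso D₁.tmPair D₂.tmPair) :
    ∃ e' : GaloisMonoidPair.Iso D₁.tlgPair D₂.tlgPair, e'.isoPi = e.isoPi := by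
  -- generic extension of a multiplicative bijection `𝒪₁^⊳ ⥲ 𝒪₂^⊳` to `k̄₁^× → k̄₂^×`
  have ne₁ : ∀ a : ↥(nonzeroIntegers C₁.k C₁.K), (a : C₁.K) ≠ 0 := fun a => a.2.2
  have ne₂ : ∀ a : ↥(nonzeroIntegers C₂.k C₂.K), (a : C₂.K) ≠ 0 := fun a => a.2.2
  -- well-definedness of `β(a)/β(b)`
  have wd : ∀ (β : ↥(nonzeroIntegers C₁.k C₁.K) ≃* ↥(nonzeroIntegers C₂.k C₂.K))
      (a b c d : ↥(nonzeroIntegers C₁.k C₁.K)),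
      (a : C₁.K) / b = c / d → (β a : C₂.K) / β b = β c / β d := by
    intro β a b c d h
    rw [div_eq_div_iff (ne₁ b) (ne₁ d)] at h
    rw [div_eq_div_iff (ne₂ _) (ne₂ _), ← Submonoid.coe_mul, ← Submonoid.coe_mul, ← map_mul,
      ← map_mul]
    congr 2
    exact Subtype.ext (by rw [Submonoid.coe_mul, Submonoid.coe_mul]; exact h)
  -- the extensions of `β := e.isoM` and of `β⁻¹`
  set β := e.isoM with hβdef
  let g₁ : ↥(nonZeroDivisors C₁.K) → C₂.K := fun x =>
    (β (C₁.exists_eq_div x).choose.1 : C₂.K) / β (C₁.exists_eq_div x).choose.2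
  let g₂ : ↥(nonZeroDivisors C₂.K) → C₁.K := fun z =>
    (β.symm (C₂.exists_eq_div z).choose.1 : C₁.K) / β.symm (C₂.exists_eq_div z).choose.2
  have hg₁ : ∀ (x : ↥(nonZeroDivisors C₁.K)) (a b : ↥(nonzeroIntegers C₁.k C₁.K)),
      (x : C₁.K) = a / b → g₁ x = β a / β b := by
    intro x a b h
    exact wd β _ _ a b ((C₁.exists_eq_div x).choose_spec.symm.trans h)
  have wd' : ∀ (a b c d : ↥(nonzeroIntegers C₂.k C₂.K)),
      (a : C₂.K) / b = c / d → (β.symm a : C₁.K) / β.symm b = β.symm c / β.symm d := by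
    intro a b c d h
    rw [div_eq_div_iff (ne₂ b) (ne₂ d)] at h
    rw [div_eq_div_iff (ne₁ _) (ne₁ _), ← Submonoid.coe_mul, ← Submonoid.coe_mul, ← map_mul,
      ← map_mul]
    congr 2
    exact Subtype.ext (by rw [Submonoid.coe_mul, Submonoid.coe_mul]; exact h)
  have hg₂ : ∀ (z : ↥(nonZeroDivisors C₂.K)) (a b : ↥(nonzeroIntegers C₂.k C₂.K)),
      (z : C₂.K) = a / b → g₂ z = β.symm a / β.symm b := by
    intro z a b h
    exact wd' _ _ a b ((C₂.exists_eq_div z).choose_spec.symm.trans h)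
  have g₁ne : ∀ x, g₁ x ≠ 0 := fun x => div_ne_zero (ne₂ _) (ne₂ _)
  have g₂ne : ∀ z, g₂ z ≠ 0 := fun z => div_ne_zero (ne₁ _) (ne₁ _)
  let γ : ↥(nonZeroDivisors C₁.K) ≃* ↥(nonZeroDivisors C₂.K) :=
    { toFun := fun x => ⟨g₁ x, mem_nonZeroDivisors_of_ne_zero (g₁ne x)⟩
      invFun := fun z => ⟨g₂ z, mem_nonZeroDivisors_of_ne_zero (g₂ne z)⟩
      left_inv := fun x => Subtype.ext (by
        obtain ⟨⟨a, b⟩, hab⟩ := C₁.exists_eq_div x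
        show g₂ ⟨g₁ x, _⟩ = x
        rw [hg₂ ⟨g₁ x, _⟩ (β a) (β b) (hg₁ x a b hab), MulEquiv.symm_apply_apply,
          MulEquiv.symm_apply_apply, hab])
      right_inv := fun z => Subtype.ext (by
        obtain ⟨⟨a, b⟩, hab⟩ := C₂.exists_eq_div z
        show g₁ ⟨g₂ z, _⟩ = z
        rw [hg₁ ⟨g₂ z, _⟩ (β.symm a) (β.symm b) (hg₂ z a b hab), MulEquiv.apply_symm_apply,
          MulEquiv.apply_symm_apply, hab])
      map_mul' := fun x y => Subtype.ext (by
        obtain ⟨⟨a, b⟩, hab⟩ := C₁.exists_eq_div x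
        obtain ⟨⟨c, d⟩, hcd⟩ := C₁.exists_eq_div y
        have hxy : ((x * y : ↥(nonZeroDivisors C₁.K)) : C₁.K) = (a * c : ↥(nonzeroIntegers C₁.k C₁.K)) /
            (b * d : ↥(nonzeroIntegers C₁.k C₁.K)) := by
          rw [Submonoid.coe_mul, hab, hcd, Submonoid.coe_mul, Submonoid.coe_mul, div_mul_div_comm]
        show g₁ (x * y) = g₁ x * g₁ y
        rw [hg₁ _ _ _ hxy, hg₁ x a b hab, hg₁ y c d hcd, map_mul, map_mul, Submonoid.coe_mul,
          Submonoid.coe_mul, div_mul_div_comm]) }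
  refine ⟨⟨e.isoPi, γ, fun g x => Subtype.ext ?_⟩, rfl⟩
  -- equivariance: `σ(a/b) = σ(a)/σ(b)` and `β(σ a) = f(σ) β(a)`
  obtain ⟨⟨a, b⟩, hab⟩ := C₁.exists_eq_div x
  have hsmul : ((g • x : ↥(nonZeroDivisors C₁.K)) : C₁.K) =
      ((g • a : ↥(nonzeroIntegers C₁.k C₁.K)) : C₁.K) / ((g • b : ↥(nonzeroIntegers C₁.k C₁.K)) : C₁.K) := by
    show D₁.aug g ((x : C₁.K)) = D₁.aug g (a : C₁.K) / D₁.aug g (b : C₁.K)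
    rw [hab, map_div₀]
  show g₁ (g • x) = D₂.aug (e.isoPi g) (g₁ x)
  rw [hg₁ _ _ _ hsmul, hg₁ x a b hab, e.smul_comm, e.smul_comm, map_div₀]
  rfl

end Extend

/-! ### §2. Mono-analytic type passes from `TM` to `TLG`; trivial arithmetic kernels -/

/-- A pair of mono-analytic type is an MLF-Galois pair. [cite: MochizukiAbsTopIII2015, Definition 3.1 (ii) p.67] -/
theorem isMLFGaloisMonoidPair_of_isOfMonoAnalyticTypeMonoid {T : PairType} {P : GaloisMonoidPair.{u}}
    (hP : IsOfMonoAnalyticTypeMonoid T P) : IsMLFGaloisMonoidPair T P := by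
  obtain ⟨C, D, Q, -, hQ, hι⟩ := hP.exists_model
  exact ⟨⟨C, D, Q, hQ, hι⟩⟩

/-- If an MLF-Galois `TM`-pair of mono-analytic type is isomorphic to the model `TM`-pair of some model
data `(k, k̄, Π_k ↠ G_k)`, then the model `TLG`-pair of that data is of mono-analytic type.
[cite: MochizukiAbsTopIII2015, Definition 3.1 (ii) p.67] -/
theorem isOfMonoAnalyticTypeMonoid_tlgPair_of_tmPair (C : MLFClosure.{0})
    (D : ModelMLFGaloisData C.k C.K) (P : GaloisMonoidPair.{0})
    (hι : Nonempty (GaloisMonoidPair.Iso D.tmPair P)) (hP : IsOfMonoAnalyticTypeMonoid .TM P) :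
    IsOfMonoAnalyticTypeMonoid .TLG D.tlgPair := by
  obtain ⟨ι⟩ := hι
  obtain ⟨C', D', Q', hbij, hQ', ⟨ι'⟩⟩ := hP.exists_model
  rw [ModelMLFGaloisData.monoidPair_TM, Option.some.injEq] at hQ'
  subst hQ'
  -- `D'.tmPair ≅ P ≅ D.tmPair`
  have e : GaloisMonoidPair.Iso D'.tmPair D.tmPair :=
    { isoPi := ι'.isoPi.trans ι.isoPi.symm
      isoM := ι'.isoM.trans ι.isoM.symm
      smul_comm := fun g x => by
        show ι.isoM.symm (ι'.isoM (g • x)) = ι.isoPi.symm (ι'.isoPi g) • ι.isoM.symm (ι'.isoM x)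
        rw [ι'.smul_comm]
        exact GaloisMonoidPair.Iso.symm_smul_comm ι _ _ }
  obtain ⟨e', -⟩ := ModelMLFGaloisData.exists_tlgPair_iso_of_tmPair_iso D' D e
  exact ⟨⟨C', D', D'.tlgPair, hbij, D'.monoidPair_TLG, ⟨e'⟩⟩⟩

/-- A `TM`-pair of mono-analytic type has trivial arithmetic kernel (`ε_k` is injective and `G_k` acts
faithfully on `𝒪_k̄^⊳`). [cite: MochizukiAbsTopIII2015, Definition 3.1 (ii) p.67] -/
theorem GaloisMonoidPair.actionKer_eq_bot_of_isOfMonoAnalyticTypeMonoid_TM (P : GaloisMonoidPair.{0})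
    (hP : IsOfMonoAnalyticTypeMonoid .TM P) : P.actionKer = ⊥ := by
  obtain ⟨C, D, Q, ⟨hbij, -⟩, hQ, ⟨ι⟩⟩ := hP.exists_model
  rw [ModelMLFGaloisData.monoidPair_TM, Option.some.injEq] at hQ
  subst hQ
  rw [← ι.map_actionKer, ModelMLFGaloisData.tmPair_actionKer C D,
    (MonoidHom.ker_eq_bot_iff D.aug).mpr hbij.1, Subgroup.map_bot]

/-- A `TLG`-pair of mono-analytic type has trivial arithmetic kernel.
[cite: MochizukiAbsTopIII2015, Definition 3.1 (ii) p.67] -/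
theorem GaloisMonoidPair.actionKer_eq_bot_of_isOfMonoAnalyticTypeMonoid_TLG (P : GaloisMonoidPair.{0})
    (hP : IsOfMonoAnalyticTypeMonoid .TLG P) : P.actionKer = ⊥ := by
  obtain ⟨C, D, Q, ⟨hbij, -⟩, hQ, ⟨ι⟩⟩ := hP.exists_model
  rw [ModelMLFGaloisData.monoidPair_TLG, Option.some.injEq] at hQ
  subst hQ
  rw [← ι.map_actionKer, ModelMLFGaloisData.tlgPair_actionKer C D,
    (MonoidHom.ker_eq_bot_iff D.aug).mpr hbij.1, Subgroup.map_bot]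

/-! ### §3. The mono-analytic `TM` lifting statement from the mono-analytic `TLG` one -/

/-- **Mono-analytic `TM` lifting FROM mono-analytic `TLG` lifting.**  If every isomorphism of
topological groups `Π ⥲ Π*` between MLF-Galois `TLG`-pairs of mono-analytic type lifts to an
isomorphism of pairs, then the same holds for MLF-Galois `TM`-pairs of mono-analytic type — i.e. the
body of abc-iut-L4-t2's `GaloisIsoLiftsToTMPairIsoOfMonoAnalytic` ([IUTchII] Rmk. 1.11.1 (i) (a))
follows from the existence part of the `TLG` clause of `UnitPairIsoFibresOfMonoAnalytic`.
[cite: MochizukiAbsTopIII2015, Proposition 3.2 (iv) p.72] -/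
theorem tmPairIso_lifts_of_tlgLifting_monoAnalytic
    (hlift : ∀ (P Q : GaloisMonoidPair.{0}), IsMLFGaloisMonoidPair .TLG P →
      IsMLFGaloisMonoidPair .TLG Q → IsOfMonoAnalyticTypeMonoid .TLG P →
        IsOfMonoAnalyticTypeMonoid .TLG Q → ∀ f : P.Pi ≃ₜ* Q.Pi,
          ∃ e : GaloisMonoidPair.Iso P Q, e.isoPi = f)
    (P Q : GaloisMonoidPair.{0}) (hP : IsMLFGaloisMonoidPair .TM P) (hQ : IsMLFGaloisMonoidPair .TM Q)
    (hPm : IsOfMonoAnalyticTypeMonoid .TM P) (hQm : IsOfMonoAnalyticTypeMonoid .TM Q)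
    (f : P.Pi ≃ₜ* Q.Pi) : ∃ e : GaloisMonoidPair.Iso P Q, e.isoPi = f := by
  have hf : P.actionKer.map f.toMulEquiv.toMonoidHom = Q.actionKer := by
    rw [P.actionKer_eq_bot_of_isOfMonoAnalyticTypeMonoid_TM hPm,
      Q.actionKer_eq_bot_of_isOfMonoAnalyticTypeMonoid_TM hQm, Subgroup.map_bot]
  exact galoisIsoLiftsToTMPairIso_of_tlgLifting_relative (IsOfMonoAnalyticTypeMonoid .TM)
    (IsOfMonoAnalyticTypeMonoid .TLG)
    (fun C D P' hι hP' => isOfMonoAnalyticTypeMonoid_tlgPair_of_tmPair C D P' hι hP')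
    (fun P' Q' hP' hQ' hHP hHQ f' _ => hlift P' Q' hP' hQ' hHP hHQ f') P Q hP hQ hPm hQm f hf

end Literature.AnabelianGeometry.AbsoluteAnabelian

end
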